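import Summits.CriticalPhenomena.PercolationContinuityZ3.Theorems.Transplant.AutChartOrbitsCriticalContinuity
import HarnessLib

/-!
# The orbit theorem (N3-a) READ ON THE COSETS OF A SUBGROUP OF A CAYLEY GRAPH'S GROUP: `p_c < 1 ∧ θ_g(p_c) = 0` on `Cay(Γ; S)` from a
# subgroup `Γ₀ ≤ Γ`, a right transversal `R`, a homomorphism `c : Γ₀ → ℤ²` and LETTER-LEVEL step / range conditions — UNCONDITIONAL

builds on p205010 (kernel theorem, internal audit signed; external expert review pending): every theorem of this file is an instance of
`AutChart.conj4_of_finite_orbits` / `criticalContinuity_of_finite_orbits_maxArea` («AutChartOrbitsCriticalContinuity» p493117 / p495338), which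
run through the aligned multi-type scaled node and so build on p205010.  Lane `prim-bschramm`, seat `prim-bschramm-p3` gen 34 (DESIGN OWNER;
`P3-NILPOTENT.md` §27, offer (O1)).  Helper file (`--supports stmt-CriticalPhenomena-4575 --as helper`); PROOFS ONLY (def-free); no `@[conjecture]` is
declared, edited or claimed; NOTHING is claimed about the end-state node `BenjaminiSchramm1996_conj4_endState` or Conjecture 4 in general.

THE POINT.  The (N3-a) orbit theorem takes a group `A` acting with finitely many orbits on a connected locally finite graph, a transversal, a
homomorphism `A → ℤ²` killing a stabiliser, and — at the representatives — edge values of sup-norm `≤ N` and the four exact single-edge steps `± N eᵢ`.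
Its Cayley customers so far (X′ = `Cay(ℤ² ⋊ C₄; ρ, x)` p494125, the dihedral skew bilayer (c3) p497785, the Heisenberg skew bilayer (c1) p496924) each
REBUILT their graph by hand on `ℤ² × Fin k` and identified it with the Cayley graph in prose.  Here the theorem is read directly on `Cay(Γ; S)` =
Mathlib's `mulCayley ↑S` for an ARBITRARY group `Γ`: the acting group is a subgroup `Γ₀ ≤ Γ` by LEFT multiplication (graph automorphisms of the right
Cayley graph, free — so the stabiliser clause is vacuous), the orbits are the right cosets `Γ₀·r`, `r ∈ R` a finite transversal, and the two
hypotheses become computations with LETTERS: writing `r·x = a·r′` (`x` a letter of `S^{±}`, `a ∈ Γ₀`, `r′ ∈ R`), every such `a` has `‖c a‖_∞ ≤ N`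
(`hlip`), and for every `r`, axis `i` and sign `σ` some letter realises `c a = N σ eᵢ` (`hstep`).
* §1 `isActionByAut_leftCoset`, `map_stabilizer_leftCoset` — the action and the vacuous stabiliser clause.
* §2 `conj4_of_cosetSteps` — adjacency form (hypotheses quantified over edges `r ∼ a·r′`, exactly the orbit theorem's shape).
* §3 **`conj4_of_cosetLetters`** — LETTER form (hypotheses quantified over `x ∈ S ∪ S⁻¹` with `r·x = a·r′`); `theta_eq_zero_of_le_of_cosetLetters`.
* §4 `conj4_of_cosetLetters_maxArea` — the max-area letter form: steps along an independent pair `b₀, b₁` of values, all letter values in its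
  closed parallelogram (re-based by the orbit theorem's §4); `p_c < 1` from the rank-two pair.
INSTANCES BY CITATION (the acting groups are not Lean objects; `P3-NILPOTENT.md` §27.1–27.2, refuter check requested 2026-08-27): (i) `Γ = ℤ ≀_X 𝔊`, the
permutational wreath product of `ℤ` over the first Grigorchuk group's orbit `X` of the ray `ρ = 1^∞` (Bartholdi–Erschler 2012, §2–§3; growth
`exp(n^{0.77} log n)`, `b₁ = 1`; trivial FC-centre — lane remark, `P3-NILPOTENT.md` §26.1), `S₂ = {a, b, c, d, s^{±}, (asa)^{±}}` with `s = δ_ρ` the lamp letter and `asa = δ_{ρa}` the lamp at the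
other level-one subtree: `Γ₀ = (⊕_X ℤ) ⋊ St_𝔊(1)` (index 2), `R = {1, a}`, `c = ` (lamp sum over `X ∩ 0T`, lamp sum over `X ∩ 1T`), `N = 1` — every
vertex has both axes along single lamp edges, so `p_c < 1 ∧ θ(p_c) = 0` at every vertex; (ii) generally `Cay(ℤ ≀_X Q; S_Q ∪ lamps)` whenever the lamp
letters' positions meet every block of a finite-index `H ≤ Q` with `Q`-invariant orbit partition ("lamp-complete" generating sets).  Bartholdi–Erschler's
STANDARD generating set `{a, b, c, d, s^{±}}` (one lamp letter) is NOT an instance (`P3-NILPOTENT.md` §26.7) and stays not proved in the tree.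
[cite: BenjaminiSchramm1996, Conj. 4; §2 (Cayley graphs, quasi-transitive graphs)] [cite: KozmaNitzan2024, §4 p. 16 (Lemma 8: the lattice symmetries)]
[cite: BartholdiErschler2012, §2 (permutational wreath products, standard generating set), §3.1 (the first Grigorchuk group; ρ = 1^∞ fixed by b, c, d)]
-/

noncomputable section

namespace Summit.CriticalPhenomena.PercolationContinuityZ3.Theorems.Transplant

open SimpleGraph Literature.Probability.Percolation Literature.Probability.LatticeModels
open scoped Classical

namespace CayleyCosets

variable {Γ : Type} [Group Γ] (S : Finset Γ)

/-! ## §1 A subgroup acting on `Cay(Γ; S)` by left multiplication: by automorphisms, freely -/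

/-- **Left multiplication by a subgroup `Γ₀ ≤ Γ` is an action on `Cay(Γ; S)` by graph automorphisms** (the Cayley graph is a right Cayley
graph). [cite: BenjaminiSchramm1996, §2 (Cayley graphs)] -/
theorem isActionByAut_leftCoset (Γ₀ : Subgroup Γ) : IsActionByAut (mulCayley (↑S : Set Γ)) Γ₀ := fun a x y =>
  show (mulCayley (↑S : Set Γ)).Adj ((a : Γ) * x) ((a : Γ) * y) ↔ (mulCayley (↑S : Set Γ)).Adj x y from mulCayley_adj_mul_iff_right

/-- The action is free: the stabiliser of every vertex is trivial, so **every homomorphism `c : Γ₀ → ℤ²` kills it** (the orbit theorem's `hstab`,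
vacuously). [folklore] -/
theorem map_stabilizer_leftCoset (Γ₀ : Subgroup Γ) (c : Γ₀ →* Multiplicative (Site 2)) (t : Γ) :
    ∀ h ∈ MulAction.stabilizer Γ₀ t, c h = 1 := fun h hh => by
  have h1 : (h : Γ) * t = t := MulAction.mem_stabilizer_iff.1 hh
  have h2 : h = 1 := Subtype.ext (mul_eq_right.1 h1)
  rw [h2, map_one]

/-- In `Cay(Γ; S)`, `r ∼ r·x` for every letter `x ≠ 1` of `S ∪ S⁻¹`. [cite: BenjaminiSchramm1996, §2 (Cayley graphs)] -/
theorem adj_mul_letter {r x : Γ} (hx : x ∈ S ∨ x⁻¹ ∈ S) (hx1 : x ≠ 1) : (mulCayley (↑S : Set Γ)).Adj r (r * x) := by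
  rw [mulCayley_adj']
  refine ⟨fun h => hx1 (mul_left_cancel (a := r) (by rw [mul_one]; exact h.symm)), ?_⟩
  rcases hx with hx | hx
  · exact ⟨x, Finset.mem_coe.2 hx, Or.inl rfl⟩
  · exact ⟨x⁻¹, Finset.mem_coe.2 hx, Or.inr (by rw [mul_inv_cancel_right])⟩

/-- Conversely every neighbour of `r` is `r·x` for a letter `x ≠ 1` of `S ∪ S⁻¹`. [cite: BenjaminiSchramm1996, §2 (Cayley graphs)] -/
theorem exists_letter_of_adj {r w : Γ} (h : (mulCayley (↑S : Set Γ)).Adj r w) : ∃ x : Γ, x ≠ 1 ∧ (x ∈ S ∨ x⁻¹ ∈ S) ∧ w = r * x := by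
  rw [mulCayley_adj'] at h
  obtain ⟨hne, g, hg, hrw | hrw⟩ := h
  · refine ⟨g, fun h1 => hne ?_, Or.inl (Finset.mem_coe.1 hg), hrw.symm⟩
    rw [← hrw, h1, mul_one]
  · refine ⟨g⁻¹, fun h1 => hne ?_, Or.inr (by rw [inv_inv]; exact Finset.mem_coe.1 hg), ?_⟩
    · rw [inv_eq_one] at h1
      rw [hrw, h1, mul_one]
    · rw [hrw, mul_inv_cancel_right]

/-! ## §2 The orbit theorem on the cosets of `Γ₀` — adjacency form -/

/-- **`p_c < 1 ∧ θ_g(p_c) = 0` on `Cay(Γ; S)` from COSET STEPS (adjacency form).**  `S` a finite generating set; `Γ₀ ≤ Γ` any subgroup with a finite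
right transversal `R` (`Γ = ⊔_{r ∈ R} Γ₀·r`); `c : Γ₀ → ℤ²` a homomorphism; a scale `N ≥ 1` such that every edge `r ∼ a·r′` (`r, r′ ∈ R`, `a ∈ Γ₀`)
has `‖c a‖_∞ ≤ N` and every `r ∈ R` has, for each axis and sign, a neighbour `a·r′` with `c a = N σ eᵢ`.  Then Conjecture 4 holds on `Cay(Γ; S)`:
the orbit theorem `AutChart.conj4_of_finite_orbits` for `Γ₀` acting by left multiplication (free, `|R|` orbits).  No growth, kernel, cylinder or
index hypothesis (finiteness of `R` is the finite index).  builds on p205010 (kernel theorem, internal audit signed; external expert review pending).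
[cite: BenjaminiSchramm1996, Conj. 4; §2 (Cayley graphs)] [cite: KozmaNitzan2024, §4 p. 16 (Lemma 8)] -/
theorem conj4_of_cosetSteps (hS : Subgroup.closure (↑S : Set Γ) = ⊤) (Γ₀ : Subgroup Γ) (R : Finset Γ)
    (hRt : ∀ r ∈ R, ∀ r' ∈ R, ∀ a : Γ₀, (a : Γ) * r = r' → r = r') (hRc : ∀ g : Γ, ∃ a : Γ₀, ∃ r ∈ R, (a : Γ) * r = g)
    (c : Γ₀ →* Multiplicative (Site 2)) (N : ℕ) (hN : 1 ≤ N)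
    (hlip : ∀ r ∈ R, ∀ r' ∈ R, ∀ a : Γ₀, (mulCayley (↑S : Set Γ)).Adj r ((a : Γ) * r') → ∀ i : Fin 2, |Multiplicative.toAdd (c a) i| ≤ N)
    (hstep : ∀ r ∈ R, ∀ (i : Fin 2) (σ : ℤˣ), ∃ (a : Γ₀) (r' : Γ), r' ∈ R ∧ (mulCayley (↑S : Set Γ)).Adj r ((a : Γ) * r') ∧
      Multiplicative.toAdd (c a) = Pi.single i ((N : ℤ) * σ))
    (g : Γ) : criticalProb (mulCayley (↑S : Set Γ)) g < 1 ∧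
      theta (mulCayley (↑S : Set Γ)) g (criticalProbIOf (mulCayley (↑S : Set Γ)) g) = 0 :=
  AutChart.conj4_of_finite_orbits (isActionByAut_leftCoset S Γ₀) (CayleyScaled.connected_mulCayley_of_closure S hS) R
    (fun r hr r' hr' a h => hRt r hr r' hr' a h) (fun w => hRc w) c (map_stabilizer_leftCoset Γ₀ c g) N hN
    (fun r hr r' hr' a h => hlip r hr r' hr' a h) (fun r hr i σ => hstep r hr i σ) g

/-! ## §3 The LETTER form -/

/-- **`p_c < 1 ∧ θ_g(p_c) = 0` on `Cay(Γ; S)` from COSET LETTERS.**  As §2, with both hypotheses read on letters: whenever `r·x = a·r′` for a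
letter `x ∈ S ∪ S⁻¹`, representatives `r, r′ ∈ R` and `a ∈ Γ₀`, the value `c a` has sup-norm `≤ N` (`hlip`); and every representative `r` admits,
for each axis `i` and sign `σ`, a letter `x` with `r·x = a·r′`, `r′ ∈ R`, `c a = N σ eᵢ` (`hstep`; such an `x` is automatically `≠ 1`).  This is the
form in which a Cayley customer is a finite computation — e.g. (by citation) `Cay(ℤ ≀_X 𝔊; a, b, c, d, s^{±}, (asa)^{±})` with `Γ₀ = (⊕_X ℤ) ⋊ St(1)`,
`R = {1, a}`, `c` = the two level-one lamp sums, `N = 1` (`P3-NILPOTENT.md` §27.1).  builds on p205010 (kernel theorem, internal audit signed; external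
expert review pending). [cite: BenjaminiSchramm1996, Conj. 4; §2 (Cayley graphs)] [cite: KozmaNitzan2024, §4 p. 16 (Lemma 8)]
[cite: BartholdiErschler2012, §2 (standard generating set), §3.1 (ρ = 1^∞ is fixed by b, c, d)] -/
theorem conj4_of_cosetLetters (hS : Subgroup.closure (↑S : Set Γ) = ⊤) (Γ₀ : Subgroup Γ) (R : Finset Γ)
    (hRt : ∀ r ∈ R, ∀ r' ∈ R, ∀ a : Γ₀, (a : Γ) * r = r' → r = r') (hRc : ∀ g : Γ, ∃ a : Γ₀, ∃ r ∈ R, (a : Γ) * r = g)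
    (c : Γ₀ →* Multiplicative (Site 2)) (N : ℕ) (hN : 1 ≤ N)
    (hlip : ∀ r ∈ R, ∀ x : Γ, (x ∈ S ∨ x⁻¹ ∈ S) → ∀ (a : Γ₀) (r' : Γ), r' ∈ R → r * x = (a : Γ) * r' →
      ∀ i : Fin 2, |Multiplicative.toAdd (c a) i| ≤ N)
    (hstep : ∀ r ∈ R, ∀ (i : Fin 2) (σ : ℤˣ), ∃ x : Γ, (x ∈ S ∨ x⁻¹ ∈ S) ∧ ∃ (a : Γ₀) (r' : Γ), r' ∈ R ∧ r * x = (a : Γ) * r' ∧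
      Multiplicative.toAdd (c a) = Pi.single i ((N : ℤ) * σ))
    (g : Γ) : criticalProb (mulCayley (↑S : Set Γ)) g < 1 ∧
      theta (mulCayley (↑S : Set Γ)) g (criticalProbIOf (mulCayley (↑S : Set Γ)) g) = 0 := by
  refine conj4_of_cosetSteps S hS Γ₀ R hRt hRc c N hN (fun r hr r' hr' a h i => ?_) (fun r hr i σ => ?_) g
  · -- an edge `r ∼ a·r′` is `r·x = a·r′` for a letter `x`
    obtain ⟨x, -, hx, hxe⟩ := exists_letter_of_adj S h
    exact hlip r hr x hx a r' hr' hxe.symm i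
  · obtain ⟨x, hx, a, r', hr', hxe, ha⟩ := hstep r hr i σ
    refine ⟨a, r', hr', ?_, ha⟩
    -- the letter is not `1`: otherwise `r = a·r′`, so `r′ = r`, `a = 1`, `c a = 0 ≠ N σ eᵢ`
    have hx1 : x ≠ 1 := by
      rintro rfl
      rw [mul_one] at hxe
      have hrr : r' = r := hRt r' hr' r hr a hxe.symm
      rw [hrr] at hxe
      have ha1 : a = 1 := Subtype.ext (mul_eq_right.1 hxe.symm)
      have h0 : Multiplicative.toAdd (c a) = 0 := by rw [ha1, map_one]; rfl
      have hi := congrFun ha i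
      rw [h0, Pi.zero_apply, Pi.single_eq_same] at hi
      have hσ : (σ : ℤ) ≠ 0 := σ.ne_zero
      have hN0 : (N : ℤ) ≠ 0 := by exact_mod_cast (show N ≠ 0 by omega)
      exact mul_ne_zero hN0 hσ hi.symm
    rw [← hxe]
    exact adj_mul_letter S hx hx1

/-- … and `θ_g(p) = 0` for every `p ≤ p_c`. builds on p205010 (kernel theorem, internal audit signed; external expert review pending).
[cite: BenjaminiSchramm1996, Conj. 4; §2] -/
theorem theta_eq_zero_of_le_of_cosetLetters (hS : Subgroup.closure (↑S : Set Γ) = ⊤) (Γ₀ : Subgroup Γ) (R : Finset Γ)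
    (hRt : ∀ r ∈ R, ∀ r' ∈ R, ∀ a : Γ₀, (a : Γ) * r = r' → r = r') (hRc : ∀ g : Γ, ∃ a : Γ₀, ∃ r ∈ R, (a : Γ) * r = g)
    (c : Γ₀ →* Multiplicative (Site 2)) (N : ℕ) (hN : 1 ≤ N)
    (hlip : ∀ r ∈ R, ∀ x : Γ, (x ∈ S ∨ x⁻¹ ∈ S) → ∀ (a : Γ₀) (r' : Γ), r' ∈ R → r * x = (a : Γ) * r' →
      ∀ i : Fin 2, |Multiplicative.toAdd (c a) i| ≤ N)
    (hstep : ∀ r ∈ R, ∀ (i : Fin 2) (σ : ℤˣ), ∃ x : Γ, (x ∈ S ∨ x⁻¹ ∈ S) ∧ ∃ (a : Γ₀) (r' : Γ), r' ∈ R ∧ r * x = (a : Γ) * r' ∧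
      Multiplicative.toAdd (c a) = Pi.single i ((N : ℤ) * σ))
    (g : Γ) {p : unitInterval} (hp : (p : ℝ) ≤ criticalProb (mulCayley (↑S : Set Γ)) g) : theta (mulCayley (↑S : Set Γ)) g p = 0 := by
  haveI : Countable Γ :=
    Literature.Barriers.CriticalPhenomena.countable_of_connected_of_locallyFinite _ (CayleyScaled.connected_mulCayley_of_closure S hS) g
  rcases hp.lt_or_eq with hlt | heq
  · exact theta_eq_zero_of_lt_criticalProb_holds _ g p hlt
  · have e : p = criticalProbIOf (mulCayley (↑S : Set Γ)) g := Subtype.ext heq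
    rw [e]
    exact (conj4_of_cosetLetters S hS Γ₀ R hRt hRc c N hN hlip hstep g).2

/-! ## §4 The max-area letter form -/

/-- **`p_c < 1 ∧ θ_g(p_c) = 0` on `Cay(Γ; S)` from COSET LETTERS, MAX-AREA FORM.**  Instead of a scale and axis values the customer gives an
INDEPENDENT pair `b 0, b 1 ∈ ℤ²`: every representative has, for `i = 0, 1` and each sign, a letter `x` with `r·x = a·r′` and `c a = ± b i`, and every
letter value `c a` (`r·x = a·r′`) lies in the closed parallelogram `|det(c a, b 1)|, |det(b 0, c a)| ≤ |det(b 0, b 1)|`.  (`θ = 0` by the orbit theorem's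
max-area form; `p_c < 1` from the rank-two pair of step values.)  builds on p205010 (kernel theorem, internal audit signed; external expert review
pending). [cite: BenjaminiSchramm1996, Conj. 4; §2 (Cayley graphs)] [cite: KozmaNitzan2024, §4 p. 16 (Lemma 8)] [cite: MartineauTassion2017, §3.2] -/
theorem conj4_of_cosetLetters_maxArea (hS : Subgroup.closure (↑S : Set Γ) = ⊤) (Γ₀ : Subgroup Γ) (R : Finset Γ)
    (hRt : ∀ r ∈ R, ∀ r' ∈ R, ∀ a : Γ₀, (a : Γ) * r = r' → r = r') (hRc : ∀ g : Γ, ∃ a : Γ₀, ∃ r ∈ R, (a : Γ) * r = g)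
    (c : Γ₀ →* Multiplicative (Site 2)) (b : Fin 2 → Site 2) (hb : MaxArea.det2 (b 0) (b 1) ≠ 0)
    (hlip : ∀ r ∈ R, ∀ x : Γ, (x ∈ S ∨ x⁻¹ ∈ S) → ∀ (a : Γ₀) (r' : Γ), r' ∈ R → r * x = (a : Γ) * r' →
      |MaxArea.det2 (Multiplicative.toAdd (c a)) (b 1)| ≤ |MaxArea.det2 (b 0) (b 1)| ∧
        |MaxArea.det2 (b 0) (Multiplicative.toAdd (c a))| ≤ |MaxArea.det2 (b 0) (b 1)|)
    (hstep : ∀ r ∈ R, ∀ (i : Fin 2) (σ : ℤˣ), ∃ x : Γ, (x ∈ S ∨ x⁻¹ ∈ S) ∧ ∃ (a : Γ₀) (r' : Γ), r' ∈ R ∧ r * x = (a : Γ) * r' ∧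
      Multiplicative.toAdd (c a) = (σ : ℤ) • b i)
    (g : Γ) : criticalProb (mulCayley (↑S : Set Γ)) g < 1 ∧
      theta (mulCayley (↑S : Set Γ)) g (criticalProbIOf (mulCayley (↑S : Set Γ)) g) = 0 := by
  have hact := isActionByAut_leftCoset S Γ₀
  have hc := CayleyScaled.connected_mulCayley_of_closure S hS
  have hRt' : ∀ r ∈ R, ∀ r' ∈ R, ∀ a : Γ₀, a • r = r' → r = r' := fun r hr r' hr' a h => hRt r hr r' hr' a h
  have hRc' : ∀ w : Γ, ∃ a : Γ₀, ∃ r ∈ R, a • r = w := fun w => hRc w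
  -- a step letter is not `1` (else `a = 1` and `c a = 0 = ± b i`, contradicting independence)
  have hb0 : ∀ (i : Fin 2) (σ : ℤˣ), (σ : ℤ) • b i ≠ 0 := by
    intro i σ h
    apply hb
    fin_cases i
    · have hbi : b 0 = 0 := by
        rcases Int.units_eq_one_or σ with rfl | rfl <;> simpa using h
      simp [MaxArea.det2, hbi]
    · have hbi : b 1 = 0 := by
        rcases Int.units_eq_one_or σ with rfl | rfl <;> simpa using h
      simp [MaxArea.det2, hbi]
  have hstep' : ∀ r ∈ R, ∀ (i : Fin 2) (σ : ℤˣ), ∃ (a : Γ₀) (r' : Γ), r' ∈ R ∧ (mulCayley (↑S : Set Γ)).Adj r (a • r') ∧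
      Multiplicative.toAdd (c a) = (σ : ℤ) • b i := by
    intro r hr i σ
    obtain ⟨x, hx, a, r', hr', hxe, ha⟩ := hstep r hr i σ
    refine ⟨a, r', hr', ?_, ha⟩
    have hx1 : x ≠ 1 := by
      rintro rfl
      rw [mul_one] at hxe
      have hrr : r' = r := hRt r' hr' r hr a hxe.symm
      rw [hrr] at hxe
      have ha1 : a = 1 := Subtype.ext (mul_eq_right.1 hxe.symm)
      have h0 : Multiplicative.toAdd (c a) = 0 := by rw [ha1, map_one]; rfl
      exact hb0 i σ (by rw [← ha, h0])
    show (mulCayley (↑S : Set Γ)).Adj r ((a : Γ) * r')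
    rw [← hxe]
    exact adj_mul_letter S hx hx1
  have hlip' : ∀ r ∈ R, ∀ r' ∈ R, ∀ a : Γ₀, (mulCayley (↑S : Set Γ)).Adj r (a • r') →
      |MaxArea.det2 (Multiplicative.toAdd (c a)) (b 1)| ≤ |MaxArea.det2 (b 0) (b 1)| ∧
        |MaxArea.det2 (b 0) (Multiplicative.toAdd (c a))| ≤ |MaxArea.det2 (b 0) (b 1)| := by
    intro r hr r' hr' a h
    obtain ⟨x, -, hx, hxe⟩ := exists_letter_of_adj S h
    exact hlip r hr x hx a r' hr' hxe.symm
  refine ⟨?_, AutChart.criticalContinuity_of_finite_orbits_maxArea hact hc R hRt' hRc' c (map_stabilizer_leftCoset Γ₀ c g) b hb hlip' hstep' g⟩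
  -- `p_c < 1`: the representative of `g` carries the rank-two pair of step values `± b 0`, `± b 1`
  obtain ⟨a₀, r₀, hr₀, hg⟩ := hRc g
  obtain ⟨a, -, -, -, ha⟩ := hstep' r₀ hr₀ 0 1
  obtain ⟨a', -, -, -, ha'⟩ := hstep' r₀ hr₀ 1 1
  refine AutChart.criticalProb_lt_one_of_finite_orbits hact hc r₀ R hRc' c (map_stabilizer_leftCoset Γ₀ c r₀) ⟨a, a', ?_⟩ g
  rw [ha, ha', Units.val_one, one_smul, one_smul]
  exact hb

end CayleyCosets

end Summit.CriticalPhenomena.PercolationContinuityZ3.Theorems.Transplant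

end
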